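import Literature.AnabelianGeometry.EtaleTheta.GalSectCuspTorsorStructureGroupKummer
import Literature.AnabelianGeometry.EtaleTheta.Discharge.Sec1CyclotomicCuspOfJointOrigin
import Literature.AnabelianGeometry.EtaleTheta.Discharge.Sec1CuspRationalOfR2
import HarnessLib

/-!
# [EtTh] Thm 1.10 (iii) at a JOINT ORIGIN: the cusp datum WITH its genuine `H¹`-torsor — the binder (gen) and
# ALL THREE print clauses feeding it («`I_x ≅ Ẑ(1)`», «`D_x` compact», «`aug(D_x) = G_K`») DERIVED from the origin

S. Mochizuki, *The étale theta function …* [EtTh], Publ. RIMS **45** (2009), Thm. 1.10 (iii) p. 30 (the `(K^×_□)^∧`-torsor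
at the unique cusp of `Ċ^log_□`), Prop. 2.2 (ii) p. 37 («splittings of `D_x ↠ G_K`»), Def. 2.1 p. 35
[cite: MochizukiEtTh2009, Thm 1.10 (iii) p.30]; S. Mochizuki, *Galois sections in absolute anabelian geometry* [GalSect],
Nagoya Math. J. **179** (2005), §4 p. 33 («`1 → I_x → D_x → G_K → 1`, `I_x ≅ Ẑ(1)` … torsor over `H¹(G_K, Ẑ(1)) ≅ (K^×)^∧`»)
[cite: MochizukiGalSect2005, §4 p.33].

abc-iut cell, layer L2, seat abc-iut-w5-d029 (gen 7); row R600 (B5) of abc-iut-L2-lead (R678, 2026-08-26T21:31:09Z).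
PROOF-ONLY knit (no definition, no `Prop` fact, no instance; nothing restated) of

* p468879 `GalSectCuspTorsorStructureGroupKummer` (this seat): (gen) = `DotCCusp.IsGenuineTorsor` ⟸ {C7e (1) `IsCyclotomicCusp`,
  `IsCompact D_x`, `aug(D_x) = G_K`} (+ a C-level datum, `D_x ≤ Π^tp_Ẍ`, a base splitting);
* p463556 `Discharge/Sec1CyclotomicCuspOfJointOrigin` (abc-iut-w5-d051): C7e (1) ⟸ joint origin (`IsEtThOrigin` + `hYcl` +
  `IsThm16Origin` + `IsTateOrigin` + abc-iut-L2-t7's `CuspLaws`) + (P3) `D_x ≤ Π^tp_Y`;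
* p458429 `Discharge/Sec1CuspRationalOfR2` (abc-iut-w5-d051): «`aug(D_x) = G_K`» ⟸ `IsThm16Origin` + (P3);

together with the two remaining inputs, DERIVED HERE from the section law C9 of `CuspLaws` (Prop. 2.2 (ii): a continuous
section `s : G_K → D_x` of `D_x ↠ G_K`):

* `ThetaSetting.CuspLaws.isCompact_decomp` — **«`D_x` is COMPACT»**: `D_x = I_x · s(G_K)` is the image of the compact
  `I_x × G_K` (`I_x ≅ Ẑ`, `G_K` profinite) under multiplication — so the compactness binder of p468879 (NOT a clause of the frozen
  `TemperedCurve` interface) is a THEOREM at every `CuspLaws` datum;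
* `ThetaSetting.CuspLaws.exists_section_range_mem_splittings` — **`s(G_K)` IS a base splitting** of `(D_x, I_x)` (closed as a
  compact subset of the Hausdorff `Π^tp_X`; `s(G_K) ∩ I_x = 1`; `s(G_K) · I_x = D_x`);

whence

* `ThetaSetting.nonempty_kxHat_mulEquiv_resKer_of_origins` — at a joint origin, for every cusp `x` with (P3):
  `Nonempty ((K^×)^∧ ≃* Ker(res : H¹(D_x, I_x) → H¹(I_x, I_x)))` at the splitting `s(G_K)`;
* **`MuTwoSetting.DotCCusp.exists_isGenuineTorsor_of_origins`** — at a joint origin of a `μ₂`-setting with a C-level datum `e`: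
  for every `ε_Z` and every cusp `x` with (P3) and `D_x ≤ Π^tp_Ẍ` there is a cusp datum `C : M.DotCCusp εZ` over
  `(inclX D_x, inclX I_x)` with `C.IsGenuineTorsor ∧ C.IsCyclotomicInertia` — [EtTh] Thm 1.10 (iii)'s «`(K^×)^∧`-torsor at the
  cusp» IS the genuine Kummer `H¹`-torsor, binder-free beyond the origin predicates; `_of_oncePuncturedData` reads (P3) off
  abc-iut-L2-t7's parameter bundle.

CENSUS TOKEN (K2 / EtTh:Thm1.10(iii), binder (gen)): at a JOINT ORIGIN with `CuspLaws` and a C-level datum, (gen) ×2 and C7e (1)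
are THEOREMS for cusp data over `(inclX D_x, inclX I_x)` with (P3) + `D_x ≤ Π^tp_Ẍ`; the residual of record is the joint origin
itself (GT-type datum; no carrier of the model zoo inhabits it — abc-iut-w5-d051's p455763 / p457976 / p458779, abc-iut-w5-d165's
p447070).  HONEST FRAMING: interface laws over the frozen root; the origin predicates are hypotheses inhabited only at models;
nothing of [EtTh]/[GalSect] is asserted for genuine tempered fundamental groups; no side taken on [IUTchIII] Cor. 3.12; typed ≠ proved.
-/

noncomputable section

namespace Literature.AnabelianGeometry.EtaleTheta

open Literature.AnabelianGeometry.SemiGraphs GalSect Thm16Sub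
open scoped Pointwise

/-! ### §1. C9 ⇒ `D_x` compact, and `s(G_K)` is a base splitting -/

namespace ThetaSetting

variable {p : ℕ} [Fact p.Prime] {D : ThetaSetting p}

namespace CuspLaws

/-- **«`D_x` is compact» from the section law C9** ([EtTh] Prop. 2.2 (ii) p. 37): with a continuous section
`s : G_K → D_x` of `D_x ↠ G_K`, `D_x = I_x · s(G_K)` is the continuous image of the compact `I_x × G_K` (`I_x ≅ Ẑ`,
[SemiAnbd] §6 p. 71; `G_K` profinite). [cite: MochizukiEtTh2009, Prop 2.2 (ii) p.37] -/
theorem isCompact_decomp (hL : D.CuspLaws) {x : D.Pt} (hx : D.IsCusp x) : IsCompact (D.decomp x : Set D.PiTemp) := by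
  obtain ⟨s, hsc, hsD, hsaug⟩ := hL.exists_continuous_section x hx
  haveI := D.compactSpace_GK
  have hI : IsCompact (D.inertia x : Set D.PiTemp) := D.toTemperedCurve.isCompact_inertia hx
  have haugGK : ∀ d : D.PiTemp, D.aug d ∈ D.GK := fun d => by
    have h : D.aug.toMonoidHom d ∈ D.aug.toMonoidHom.range := ⟨d, rfl⟩
    rw [D.range_aug] at h
    exact h
  have himg : (D.decomp x : Set D.PiTemp) =
      (fun q : D.PiTemp × D.GK => q.1 * s q.2) '' ((D.inertia x : Set D.PiTemp) ×ˢ (Set.univ : Set D.GK)) := by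
    ext d
    constructor
    · intro hd
      refine ⟨(d * (s ⟨D.aug d, haugGK d⟩)⁻¹, ⟨D.aug d, haugGK d⟩), ⟨?_, Set.mem_univ _⟩, ?_⟩
      · have hd' : d ∈ D.decomp x := hd
        refine ⟨(D.decomp x).mul_mem hd' ((D.decomp x).inv_mem (hsD _)), ?_⟩
        change D.aug (d * (s ⟨D.aug d, haugGK d⟩)⁻¹) = 1
        rw [map_mul, map_inv, hsaug, mul_inv_cancel]
      · change d * (s ⟨D.aug d, haugGK d⟩)⁻¹ * s ⟨D.aug d, haugGK d⟩ = d
        rw [inv_mul_cancel_right]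
    · rintro ⟨⟨i, σ⟩, ⟨hi, -⟩, rfl⟩
      exact mul_mem (Subgroup.mem_inf.mp hi).1 (hsD σ)
  rw [himg]
  exact (hI.prod isCompact_univ).image ((continuous_fst).mul (hsc.comp continuous_snd))

/-- **`s(G_K)` is a base splitting of `(D_x, I_x)`** for the continuous section `s` of C9 ([EtTh] Prop. 2.2 (ii) p. 37 «splittings
of `D_x ↠ G_K`»): closed (compact image in the Hausdorff `Π^tp_X`), inside `D_x`, meeting `I_x` trivially, with
`s(G_K) · I_x = D_x`. [cite: MochizukiEtTh2009, Prop 2.2 (ii) p.37] -/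
theorem exists_section_range_mem_splittings (hL : D.CuspLaws) {x : D.Pt} (hx : D.IsCusp x) :
    ∃ s : ↥D.GK →* D.PiTemp, Continuous s ∧ (∀ σ, s σ ∈ D.decomp x) ∧ (∀ σ, D.aug (s σ) = (σ : GQp p)) ∧
      s.range ∈ (cuspPairOf D.toTemperedCurve x).splittings := by
  obtain ⟨s, hsc, hsD, hsaug⟩ := hL.exists_continuous_section x hx
  haveI := D.compactSpace_GK
  haveI : T2Space D.PiTemp :=
    haveI := D.isProfiniteCompletion_toHat.t2Space
    T2Space.of_injective_continuous D.toHat_injective D.toHat.continuous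
  refine ⟨s, hsc, hsD, hsaug, ?_, ?_, ?_, ?_⟩
  · -- closed
    rw [MonoidHom.coe_range]
    exact (isCompact_range hsc).isClosed
  · -- inside `D_x`
    rintro _ ⟨σ, rfl⟩
    exact hsD σ
  · -- meets `I_x` trivially
    refine (Subgroup.eq_bot_iff_forall _).mpr ?_
    rintro _ ⟨⟨σ, rfl⟩, hI⟩
    have h1 : (σ : GQp p) = 1 := by
      rw [← hsaug σ]
      exact (Subgroup.mem_inf.mp hI).2
    rw [show σ = 1 from Subtype.ext h1, map_one]
  · -- generates `D_x` together with `I_x`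
    have haugGK : ∀ d : D.PiTemp, D.aug d ∈ D.GK := fun d => by
      have h : D.aug.toMonoidHom d ∈ D.aug.toMonoidHom.range := ⟨d, rfl⟩
      rw [D.range_aug] at h
      exact h
    refine le_antisymm (sup_le (by rintro _ ⟨σ, rfl⟩; exact hsD σ) inf_le_left) fun d hd => ?_
    have hdec : d = s ⟨D.aug d, haugGK d⟩ * ((s ⟨D.aug d, haugGK d⟩)⁻¹ * d) := by rw [mul_inv_cancel_left]
    rw [hdec]
    have hd' : d ∈ D.decomp x := hd
    refine Subgroup.mul_mem _ (Subgroup.mem_sup_left ⟨_, rfl⟩) (Subgroup.mem_sup_right ⟨?_, ?_⟩)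
    · exact (D.decomp x).mul_mem ((D.decomp x).inv_mem (hsD _)) hd'
    · change D.aug ((s ⟨D.aug d, haugGK d⟩)⁻¹ * d) = 1
      rw [map_mul, map_inv, hsaug, inv_mul_cancel]

end CuspLaws

/-! ### §2. `(K^×)^∧ ≃* Ker(res)` at every cusp of a joint origin -/

/-- **At a JOINT ORIGIN the structure group of the [GalSect] §4 torsor at every cusp with (P3) is `(K^×)^∧`**: the three
print clauses of p468879 are supplied by the origin — «`I_x ≅ Ẑ(1)`» (abc-iut-w5-d051's `isCyclotomicCusp_of_origins`),
«`D_x` compact» and the base splitting `s(G_K)` (C9, §1), «`aug(D_x) = G_K`» (`IsThm16Origin.map_aug_decomp_eq_GK`).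
[cite: MochizukiGalSect2005, §4 p.33] -/
theorem nonempty_kxHat_mulEquiv_resKer_of_origins (hO : D.IsEtThOrigin)
    (hYcl : (D.DtpY.map D.toHat.toMonoidHom).topologicalClosure ≤
      D.DtpY.map D.toHat.toMonoidHom ⊔ (⁅⁅D.DeltaHat, D.DeltaHat⁆, D.DeltaHat⁆).topologicalClosure)
    (h16 : D.IsThm16Origin) (hT : D.IsTateOrigin) (hL : D.CuspLaws) {x : D.Pt} (hx : D.IsCusp x) (hP3 : D.decomp x ≤ D.GtpY) :
    ∃ (s : ↥D.GK →* D.PiTemp) (hS₀ : s.range ∈ (cuspPairOf D.toTemperedCurve x).splittings),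
      haveI : IsMulCommutative (cuspPairOf D.toTemperedCurve x).I := D.toTemperedCurve.isMulCommutative_inertia hx
      haveI := (cuspPairOf D.toTemperedCurve x).ID_normal
      Nonempty (KxHat D.toTemperedCurve ≃* ContH1.resKer (cuspPairOf D.toTemperedCurve x).ID
        (⊤ : Subgroup (cuspPairOf D.toTemperedCurve x).D)
        ((cuspPairOf D.toTemperedCurve x).isClosedComplement_of_mem_splittings hS₀).le_left) := by
  obtain ⟨s, -, -, -, hS₀⟩ := hL.exists_section_range_mem_splittings hx
  haveI : T2Space D.PiTemp :=
    haveI := D.isProfiniteCompletion_toHat.t2Space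
    T2Space.of_injective_continuous D.toHat_injective D.toHat.continuous
  exact ⟨s, hS₀, GalSect.nonempty_kxHat_mulEquiv_resKer_of_isCyclotomicCusp D.toTemperedCurve hx
    (D.isCyclotomicCusp_of_origins hO hYcl h16 hT hL hx hP3) (hL.isCompact_decomp hx) (h16.map_aug_decomp_eq_GK hx hP3) hS₀⟩

end ThetaSetting

/-! ### §3. [EtTh] Thm 1.10 (iii)'s cusp datum with its GENUINE torsor at a joint origin -/

namespace MuTwoSetting.DotCCusp

variable {p : ℕ} [Fact p.Prime] {M : MuTwoSetting p}

/-- **(gen) AND C7e (1) at a joint origin — THEOREMS.**  Let `M` be a `μ₂`-setting whose theta setting is a joint origin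
(`IsEtThOrigin` + `hYcl` + `IsThm16Origin` + `IsTateOrigin`) with abc-iut-L2-t7's `CuspLaws`, `e` a C-level datum.  Then for every
`ε_Z` and every cusp `x` with (P3) `D_x ≤ Π^tp_Y` and `D_x ≤ Π^tp_Ẍ` there is an [EtTh] Thm 1.10 (iii) cusp datum
`C : M.DotCCusp εZ` over `(inclX D_x, inclX I_x)` whose `(K^×)^∧`-torsor IS the genuine `H¹`-torsor (`IsGenuineTorsor` — the
END-KNIT binder (gen)) and whose inertia is cyclotomic (`IsCyclotomicInertia` — C7e (1)): p468879 fed by p463556 (clause (1)),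
p458429 («`aug(D_x) = G_K`») and §1 («`D_x` compact», base splitting `s(G_K)`). [cite: MochizukiEtTh2009, Thm 1.10 (iii) p.30] -/
theorem exists_isGenuineTorsor_of_origins (hO : M.IsEtThOrigin)
    (hYcl : (M.DtpY.map M.toHat.toMonoidHom).topologicalClosure ≤
      M.DtpY.map M.toHat.toMonoidHom ⊔ (⁅⁅M.DeltaHat, M.DeltaHat⁆, M.DeltaHat⁆).topologicalClosure)
    (h16 : M.IsThm16Origin) (hT : M.IsTateOrigin) (hL : M.CuspLaws) (e : M.CLevelData) (εZ : M.GtpC)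
    {x : M.Pt} (hx : M.IsCusp x) (hD : M.decomp x ≤ M.GtpXdd) (hP3 : M.decomp x ≤ M.GtpY) :
    haveI := M.t1Space_GtpC e
    ∃ C : M.DotCCusp εZ, C.IsGenuineTorsor ∧ C.IsCyclotomicInertia ∧
      C.pair = (cuspPairOf M.toTemperedCurve x).pushforward M.inclX := by
  obtain ⟨s, -, -, -, hS₀⟩ := ThetaSetting.CuspLaws.exists_section_range_mem_splittings hL hx
  exact exists_isGenuineTorsor_and_isCyclotomicInertia_of_isCyclotomicCusp e εZ hx hD hS₀
    (M.toThetaSetting.isCyclotomicCusp_of_origins hO hYcl h16 hT hL hx hP3)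
    (ThetaSetting.CuspLaws.isCompact_decomp hL hx) (h16.map_aug_decomp_eq_GK hx hP3)

/-- **… with (P3) read off the parameter bundle `OncePuncturedData`** (abc-iut-L2-t7; `decomp_le_ker_toZ`).
[cite: MochizukiEtTh2009, Thm 1.10 (iii) p.30] -/
theorem exists_isGenuineTorsor_of_oncePuncturedData (hO : M.IsEtThOrigin)
    (hYcl : (M.DtpY.map M.toHat.toMonoidHom).topologicalClosure ≤
      M.DtpY.map M.toHat.toMonoidHom ⊔ (⁅⁅M.DeltaHat, M.DeltaHat⁆, M.DeltaHat⁆).topologicalClosure)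
    (h16 : M.IsThm16Origin) (hT : M.IsTateOrigin) (hL : M.CuspLaws) (P : M.toThetaSetting.OncePuncturedData)
    (e : M.CLevelData) (εZ : M.GtpC) {x : M.Pt} (hx : M.IsCusp x) (hD : M.decomp x ≤ M.GtpXdd) :
    haveI := M.t1Space_GtpC e
    ∃ C : M.DotCCusp εZ, C.IsGenuineTorsor ∧ C.IsCyclotomicInertia ∧
      C.pair = (cuspPairOf M.toTemperedCurve x).pushforward M.inclX :=
  exists_isGenuineTorsor_of_origins hO hYcl h16 hT hL e εZ hx hD (P.decomp_le_ker_toZ x hx)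

end MuTwoSetting.DotCCusp

end Literature.AnabelianGeometry.EtaleTheta

end
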